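import Literature.NumberTheory.ConnesConsani2021.EpsSlopeKernel
import Literature.NumberTheory.ConnesConsani2021.EpsSlopeFrobeniusSeries
import Literature.NumberTheory.ConnesConsani2021.EpsSlopeFrobeniusBridge
import Literature.NumberTheory.ConnesConsani2021.EpsSlopeTailFrame
import HarnessLib

/-!
# Connes–Consani 2021, Lemma 5.4: `ε′(1⁺) = Σ_n t(n) ∈ [22.9, 23.1]` — the (E-b) enclosure IN THE KERNEL

RH-FREE (label, line 1).  bears_on (cell rh-crit, corpus C1): apex input (B) — route «ConnesConsaniSemilocal»
item K2 `DensitySlope` (stmt 19308): this file PROVES the (E-b) conjunct of `CC2021_section6_enclosures`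
VERBATIM — `epsSlope_enclosure_holds : ∀ ψ, (∀ n, IsProlateFunction 1 (2n) (ψ n)) →
22.9 ≤ Σ' n, epsSlopeTerm (ψ n) ∧ Σ' n, epsSlopeTerm (ψ n) ≤ 23.1` — so that the external numerical fact
shrinks to its (E-a) half.  Source of the number: A. Connes, C. Consani, *Weil positivity and trace formula,
the archimedean place*, Selecta Math. 27 (2021) = arXiv:2006.13771, Lemma 5.4 §5 pp. 32–33:
`ε′(1⁺) = Σ_n λ(n)²(1−λ(n)²)⁻¹ξ_n(1)² ≃ 22.9965 = 11.9719 + 8.77574 + 2.20528 + 0.0433983 + …`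
[cite: ConnesConsani2021, Lemma 5.4 §5 pp. 32–33 (arXiv item Lemma 31, chunk p0020:L86–L101)].

## Architecture (cell rh-crit (E-b) Tier 1 + Tier 2; cc-lead R70/R71/R75/R80)

* KERNEL (`EpsSlopeKernel.lean`, rh-crit-cc-eng-1): `FI` interval arithmetic at scale `2^48` run by
  `decide +kernel` on the Frobenius recursion of `frobSol 1 χ` for four `χ`-brackets (centred at
  `χ_{2n}(2π)`, `n = 0..3`), the tail checks (`q = 13/20`), and the bridge to REAL statements:
  `endSigns_of_checks` (certified opposite signs of `u′(0; χ±)`), `bracketFacts_of_checks`,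
  `summable_abs_tail_le_T`, `sum_abs_mul_SC_le_sAbs`, and `slopeCheck_eq_true`.
* FROBENIUS TOOLS (gm-t16): `exists_critical_of_sign_change` (IVT ⇒ critical `b` in the bracket),
  `prolateFun_eq_frobEvenExt` / `prolateEigen_eq_of_frobSol` / `prolateFun_one_sq_eq_of_frobSol` /
  `epsSlopeTerm_prolateFun_eq_of_frobSol` (the tree prolate data READ OFF `u_b`: `λ = 2∫₀¹u/u(0)`,
  `ψ(1)² = 1/(2∫₀¹u²)`), `ne_of_frobSol_critical` (distinct `b` ⇒ distinct indices; no zero counting);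
  SERIES LINKS (t15, `EpsSlopeFrobeniusSeries.lean`): `∫₀¹u = Σ a_k/(k+1)`, `∫₀¹u² = ΣΣ a_ia_j/(i+j+1)`
  with tail controls.
* FRAME (gm-t16, `EpsSlopeTailFrame.lean`): the index-free Bessel tail theorem
  `tsum_epsSlopeTerm_mem_Icc_of_certificate`.
* THIS FILE (t15): per mode, IVT ⇒ `b_j`, the real quantities `u(0), ∫₀¹u, ∫₀¹u²` inside the kernel's
  widened intervals, the read-back of `modeQuantities`/`totals`/`slopeCheck` into the six real hypotheses
  `ha hb hS hM hΛ hB` of the frame, four pairwise-distinct indices, the plug, and the `ψ`-form bridge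
  (`ψ n = prolateFun n` by `eq_prolateFun_of_isProlateFunction`).
Nothing in this file mentions `ζ` or RH; nothing here bears on the truth of RH.
-/

noncomputable section

open Real Set Filter MeasureTheory intervalIntegral Finset

namespace Literature.NumberTheory.ConnesConsani2021.SlopeCert

open Literature.Analysis.ValidatedNumerics.Numerics Literature.NumberTheory.LFunctions

/-! ## §1 Small real/integer bookkeeping -/

/-- `x ∈ [lo·2⁻⁴⁸, hi·2⁻⁴⁸] ⇒ x ∈ ⟨lo, hi⟩`. [cite: ConnesConsani2021, Lemma 5.4 §5 p. 33 (in-kernel certificate for ε′(1⁺) ≃ 22.9965)] -/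
theorem mem_of_Icc {x : ℝ} {lo hi : ℤ} (h : x ∈ Icc ((lo : ℝ) / SC) ((hi : ℝ) / SC)) :
    FI.mem x ⟨lo, hi⟩ := by
  have hSC := SC_pos
  refine ⟨?_, ?_⟩
  · have := h.1; rwa [div_le_iff₀ hSC] at this
  · have := h.2; rwa [le_div_iff₀ hSC] at this

/-- Integer floor division against reals: `n/m ≤ ⌊n/m⌋ + 1` (`m > 0`). [folklore] -/
private theorem int_div_real_le_ediv_add_one (n : ℤ) {m : ℤ} (hm : 0 < m) :
    (n : ℝ) / m ≤ ((n / m : ℤ) : ℝ) + 1 := by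
  have h1 : n % m < m := Int.emod_lt_of_pos n hm
  have h3 : n % m + m * (n / m) = n := Int.emod_add_mul_ediv n m
  have hmr : (0 : ℝ) < m := by exact_mod_cast hm
  rw [div_le_iff₀ hmr]
  have h3r : ((n % m : ℤ) : ℝ) + (m : ℝ) * ((n / m : ℤ) : ℝ) = n := by exact_mod_cast h3
  have h1r : ((n % m : ℤ) : ℝ) < m := by exact_mod_cast h1
  nlinarith

/-- `SC` as a positive integer. [folklore] -/
private theorem SCZ_pos' : (0 : ℤ) < (SC : ℤ) := by exact_mod_cast Nat.pos_of_ne_zero (by norm_num [SC])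

/-! ## §2 One mode: from the kernel data to the real enclosures of `λ²`, `ψ(1)²`, `λ²ψ(1)²`, `t` -/

/-- **The per-mode package.**  For a mode `d` whose bracket test passes, whose three tail checks pass
(`modeTailOK`), and whose quotient intervals exist (`modeQuantities d = some q`): there are a critical
parameter `b` in the bracket (`u_b′(0) = 0`, by IVT from the certified end signs) and its zero count `k`,
and the tree's `λ(k)², ψ_k(1)², λ(k)²ψ_k(1)², t(k) = epsSlopeTerm (prolateFun k)` lie in the four
intervals of `q`. [cite: ConnesConsani2021, Lemma 5.4 §5 pp. 32–33 (ε′(1⁺) = Σ t(n))] -/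
theorem mode_package (d : ModeData) (Bnum c : ℕ) (hok : modeTailOK (d, (Bnum, c)) = true)
    (hb : bracketOK d = true) (hle : d.chiLo ≤ d.chiHi) {q : FI × FI × FI × FI}
    (hq : modeQuantities d = some q) :
    ∃ (b : ℝ) (k : ℕ), frobSol₁ 1 b 0 = 0 ∧ (d.chiLo : ℝ) / SC ≤ b ∧ b ≤ (d.chiHi : ℝ) / SC ∧
      {x | x ∈ Ioo (0 : ℝ) 1 ∧ frobSol 1 b x = 0}.ncard = k ∧
      FI.mem (prolateEigen k ^ 2) q.1 ∧ FI.mem (prolateFun k 1 ^ 2) q.2.1 ∧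
      FI.mem (prolateEigen k ^ 2 * prolateFun k 1 ^ 2) q.2.2.1 ∧
      FI.mem (epsSlopeTerm (prolateFun k)) q.2.2.2 := by
  have hSC := SC_pos
  -- the three tail checks
  simp only [modeTailOK, Bool.and_eq_true] at hok
  obtain ⟨⟨hT, hTlo⟩, hThi⟩ := hok
  -- IVT: a critical parameter in the bracket
  have hle' : (d.chiLo : ℝ) / SC ≤ (d.chiHi : ℝ) / SC :=
    div_le_div_of_nonneg_right (by exact_mod_cast hle) hSC.le
  have hsigns := endSigns_of_checks hTlo hThi hb
  obtain ⟨b, hbI, hB⟩ : ∃ b ∈ Icc ((d.chiLo : ℝ) / SC) ((d.chiHi : ℝ) / SC), frobSol₁ 1 b 0 = 0 := by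
    cases hs : d.sLo
    · obtain ⟨h1, h2⟩ := hsigns.2 hs
      exact exists_critical_of_sign_change hle' h1.le h2.le
    · obtain ⟨h1, h2⟩ := hsigns.1 hs
      exact exists_critical_of_sign_change' hle' h1.le h2.le
  have hχ : FI.mem b d.chi := mem_of_Icc hbI
  set k : ℕ := {x | x ∈ Ioo (0 : ℝ) 1 ∧ frobSol 1 b x = 0}.ncard with hk
  refine ⟨b, k, hB, hbI.1, hbI.2, rfl, ?_⟩
  -- the kernel's real facts on the bracket
  obtain ⟨-, hR2, hmemU0, -, hmemI, hmemD⟩ := bracketFacts_of_checks hT hχ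
  obtain ⟨-, hτ⟩ := summable_abs_tail_le_T hT hχ
  set u0 : ℝ := frobSol 1 b 0 with hu0
  set I1 : ℝ := ∫ x in (0 : ℝ)..1, frobSol 1 b x with hI1
  set I2 : ℝ := ∫ x in (0 : ℝ)..1, frobSol 1 b x ^ 2 with hI2
  set τ : ℝ := ∑' j : ℕ, |frobCoeff 1 b (j + (d.K + 1))| with hτdef
  have hτ0 : 0 ≤ τ := tsum_nonneg fun _ ↦ abs_nonneg _
  -- memberships of u(0), ∫u, ∫u² in the widened intervals of `modeEncl`
  have hU : FI.mem u0 (modeEncl d).1 := by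
    simp only [modeEncl]
    refine FI.mem_widen hmemU0 ?_
    rw [← le_div_iff₀ hSC]; exact hR2
  have hI1m : FI.mem I1 (modeEncl d).2.1 := by
    simp only [modeEncl]
    refine FI.mem_widen hmemI ?_
    rw [← le_div_iff₀ hSC]
    exact (abs_integral_frobSol_one_sub_le b (d.K + 1)).trans hτ
  have hI2m : FI.mem I2 (modeEncl d).2.2 := by
    simp only [modeEncl]
    refine FI.mem_widen hmemD ?_
    set sAbs : ℤ := (sumFI (fun k ↦ let A := frobCoeffFI d.chi k; ⟨-A.absHi, A.absHi⟩) (d.K + 1)).hi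
    set A : ℝ := ∑ j ∈ range (d.K + 1), |frobCoeff 1 b j| with hAdef
    have hA0 : 0 ≤ A := Finset.sum_nonneg fun _ _ ↦ abs_nonneg _
    have hAs : A * SC ≤ (sAbs : ℝ) := sum_abs_mul_SC_le_sAbs hχ (d.K + 1)
    have h1 := abs_integral_frobSol_sq_one_sub_le b (d.K + 1)
    have hT0 : (0 : ℝ) ≤ d.T := by positivity
    -- |I2 − ΣΣ|·SC ≤ (2 A τ + τ²)·SC ≤ (2·sAbs·T + T²)/SC ≤ ⌊(2 sAbs T + T T)/SC⌋ + 1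
    have h2 : (2 * A * τ + τ ^ 2) * SC ≤ (2 * (sAbs : ℝ) * (d.T : ℝ) + (d.T : ℝ) * (d.T : ℝ)) / SC := by
      rw [le_div_iff₀ hSC]
      have hτ' : τ * SC ≤ d.T := by rw [← le_div_iff₀ hSC]; exact hτ
      have hAτ : A * SC * (τ * SC) ≤ sAbs * d.T := mul_le_mul hAs hτ' (by positivity) (by
        have : (0 : ℝ) ≤ A * SC := by positivity
        linarith)
      have hττ : τ * SC * (τ * SC) ≤ d.T * d.T := mul_le_mul hτ' hτ' (by positivity) hT0
      nlinarith
    have h3 := int_div_real_le_ediv_add_one (2 * sAbs * d.T + d.T * d.T) SCZ_pos'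
    push_cast at h3 ⊢
    calc |I2 - ∑ i ∈ range (d.K + 1), ∑ j ∈ range (d.K + 1),
            frobCoeff 1 b i * frobCoeff 1 b j / ((i : ℝ) + j + 1)| * SC
        ≤ (2 * A * τ + τ ^ 2) * SC := by gcongr
      _ ≤ _ := h2.trans h3
  -- read the quotients
  have hLdef : prolateEigen k = 2 * I1 / u0 := prolateEigen_eq_of_frobSol hB rfl
  have hPdef : prolateFun k 1 ^ 2 = 1 / (2 * I2) := prolateFun_one_sq_eq_of_frobSol hB rfl
  have hTdef : epsSlopeTerm (prolateFun k) =
      2 * (2 * I1 / u0) ^ 2 / (1 - (2 * I1 / u0) ^ 2) * (1 / (2 * I2)) :=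
    epsSlopeTerm_prolateFun_eq_of_frobSol hB rfl
  -- decode `modeQuantities`
  simp only [modeQuantities] at hq
  set E := modeEncl d with hE
  -- the eigenvalue quotient
  obtain ⟨lam, hlamEq, hlamMem⟩ : ∃ lam : FI,
      (if 0 < E.1.lo then (E.2.1.mulInt 2).divPos E.1
        else if E.1.hi < 0 then (E.2.1.mulInt (-2)).divPos E.1.neg else none) = some lam ∧
      FI.mem (2 * I1 / u0) lam := by
    by_cases h1 : 0 < E.1.lo
    · rw [if_pos h1] at hq ⊢
      cases hdp : FI.divPos (E.2.1.mulInt 2) E.1 with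
      | none => rw [hdp] at hq; simp at hq
      | some lam =>
        refine ⟨lam, rfl, ?_⟩
        have := FI.mem_divPos hdp (FI.mem_mulInt hI1m 2) hU
        push_cast at this
        rwa [mul_comm] at this
    · rw [if_neg h1] at hq ⊢
      by_cases h2 : E.1.hi < 0
      · rw [if_pos h2] at hq ⊢
        cases hdp : FI.divPos (E.2.1.mulInt (-2)) E.1.neg with
        | none => rw [hdp] at hq; simp at hq
        | some lam =>
          refine ⟨lam, rfl, ?_⟩
          have := FI.mem_divPos hdp (FI.mem_mulInt hI1m (-2)) (FI.mem_neg hU)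
          push_cast at this
          have e : I1 * -2 / -u0 = 2 * I1 / u0 := by
            rw [show I1 * -2 = -(2 * I1) by ring, neg_div_neg_eq]
          rwa [e] at this
      · rw [if_neg h2] at hq
        simp at hq
  rw [hlamEq] at hq
  simp only at hq
  cases hp : FI.divPos (FI.ofInt 1) (E.2.2.mulInt 2) with
  | none => rw [hp] at hq; simp at hq
  | some p1 =>
    rw [hp] at hq
    simp only at hq
    have hPmem : FI.mem (1 / (2 * I2)) p1 := by
      have := FI.mem_divPos hp (FI.mem_ofInt 1) (FI.mem_mulInt hI2m 2)
      push_cast at this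
      rwa [mul_comm I2 2] at this
    have hL2mem : FI.mem ((2 * I1 / u0) ^ 2) lam.sqr := FI.mem_sqr hlamMem
    cases ht : FI.divPos ((lam.sqr.mulInt 2).mul p1) ((FI.ofInt 1).sub lam.sqr) with
    | none => rw [ht] at hq; simp at hq
    | some t =>
      rw [ht] at hq
      simp only [Option.some.injEq] at hq
      subst hq
      have htmem : FI.mem (2 * (2 * I1 / u0) ^ 2 / (1 - (2 * I1 / u0) ^ 2) * (1 / (2 * I2))) t := by
        have := FI.mem_divPos ht (FI.mem_mul (FI.mem_mulInt hL2mem 2) hPmem)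
          (FI.mem_sub (FI.mem_ofInt 1) hL2mem)
        push_cast at this
        have e : (2 * I1 / u0) ^ 2 * 2 * (1 / (2 * I2)) / (1 - (2 * I1 / u0) ^ 2) =
            2 * (2 * I1 / u0) ^ 2 / (1 - (2 * I1 / u0) ^ 2) * (1 / (2 * I2)) := by ring
        rwa [e] at this
      simp only
      rw [hLdef, hPdef, hTdef]
      exact ⟨hL2mem, hPmem, FI.mem_mul hL2mem hPmem, htmem⟩


/-! ## §3 The four modes of record and the decoding of the kernel verdict -/

/-- Mode 0 (bracket at `χ₀(2π)`). [cite: ConnesConsani2021, Lemma 5.4 §5 p. 33 (t(0) ≃ 11.9719)] -/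
def D0 : ModeData := ⟨1546449985993831, 1546449986124903, 40, 712, 30434, false⟩
/-- Mode 1 (bracket at `χ₂(2π)`). [cite: ConnesConsani2021, Lemma 5.4 §5 p. 33 (t(1) ≃ 8.77574)] -/
def D1 : ModeData := ⟨7553145724163317, 7553145724687605, 40, 207, 8812, true⟩
/-- Mode 2 (bracket at `χ₄(2π)`). [cite: ConnesConsani2021, Lemma 5.4 §5 p. 33 (t(2) ≃ 2.20528)] -/
def D2 : ModeData := ⟨12079789601160093, 12079789603257245, 40, 142, 6021, false⟩
/-- Mode 3 (bracket at `χ₆(2π)`). [cite: ConnesConsani2021, Lemma 5.4 §5 p. 33 (t(3) ≃ 0.0433983)] -/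
def D3 : ModeData := ⟨17777562293405133, 17777562297599437, 42, 96, 4260, true⟩

/-- The modes of record are `D0..D3`. [folklore] -/
private theorem modes_eq : modes = [D0, D1, D2, D3] := rfl
/-- The tail constants of record. [folklore] -/
private theorem tailConsts_eq : tailConsts = [(9254209308, 34), (2648408586, 13), (1765605724, 4), (2737931749, 24)] := rfl

/-- The twelve tail checks, unpacked per mode. [cite: ConnesConsani2021, Lemma 5.4 §5 p. 33 (in-kernel certificate for ε′(1⁺) ≃ 22.9965)] -/
theorem modeTailOK_each :
    modeTailOK (D0, (9254209308, 34)) = true ∧ modeTailOK (D1, (2648408586, 13)) = true ∧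
      modeTailOK (D2, (1765605724, 4)) = true ∧ modeTailOK (D3, (2737931749, 24)) = true := by
  have h := modeTailOK_all
  rw [modes_eq, tailConsts_eq] at h
  simpa [List.all_cons] using h

/-- **The kernel verdict, decoded**: the four quotient packages exist and the scaled-integer inequalities
of `slopeCheck` hold for their sums, together with the four bracket tests.
[cite: ConnesConsani2021, Lemma 5.4 §5 p. 33 (in-kernel certificate for ε′(1⁺) ≃ 22.9965)] -/
theorem slopeCheck_decoded :
    ∃ q0 q1 q2 q3 : FI × FI × FI × FI,
      modeQuantities D0 = some q0 ∧ modeQuantities D1 = some q1 ∧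
      modeQuantities D2 = some q2 ∧ modeQuantities D3 = some q3 ∧
      bracketOK D0 = true ∧ bracketOK D1 = true ∧ bracketOK D2 = true ∧ bracketOK D3 = true ∧
      229 * (SC : ℤ) ≤ 10 * ((q0.2.2.2.add q1.2.2.2).add (q2.2.2.2.add q3.2.2.2)).lo ∧
      4 * ((2978 * (SC : ℤ)) / 1000 + 1 - ((q0.1.add q1.1).add (q2.1.add q3.1)).lo) ≤ 3 * SC ∧
      0 ≤ (SC : ℤ) - ((q0.2.2.1.add q1.2.2.1).add (q2.2.2.1.add q3.2.2.1)).lo ∧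
      10 * (((q0.2.2.2.add q1.2.2.2).add (q2.2.2.2.add q3.2.2.2)).hi +
          8 * ((SC : ℤ) - ((q0.2.2.1.add q1.2.2.1).add (q2.2.2.1.add q3.2.2.1)).lo)) ≤ 231 * SC := by
  have hs := slopeCheck_eq_true
  unfold slopeCheck at hs
  rw [Bool.and_eq_true] at hs
  obtain ⟨hbr, hrest⟩ := hs
  have hbr' : bracketOK D0 = true ∧ bracketOK D1 = true ∧ bracketOK D2 = true ∧ bracketOK D3 = true := by
    rw [bracketsOK, modes_eq] at hbr
    simpa [List.all_cons] using hbr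
  -- the four quotient packages exist (else `totals = none` and the check fails)
  obtain ⟨q0, h0⟩ : ∃ q0, modeQuantities D0 = some q0 := by
    cases h : modeQuantities D0 with
    | some q0 => exact ⟨q0, rfl⟩
    | none => exfalso; unfold totals at hrest; rw [modes_eq] at hrest; simp [h] at hrest
  obtain ⟨q1, h1⟩ : ∃ q1, modeQuantities D1 = some q1 := by
    cases h : modeQuantities D1 with
    | some q1 => exact ⟨q1, rfl⟩
    | none => exfalso; unfold totals at hrest; rw [modes_eq] at hrest; simp [h0, h] at hrest
  obtain ⟨q2, h2⟩ : ∃ q2, modeQuantities D2 = some q2 := by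
    cases h : modeQuantities D2 with
    | some q2 => exact ⟨q2, rfl⟩
    | none => exfalso; unfold totals at hrest; rw [modes_eq] at hrest; simp [h0, h1, h] at hrest
  obtain ⟨q3, h3⟩ : ∃ q3, modeQuantities D3 = some q3 := by
    cases h : modeQuantities D3 with
    | some q3 => exact ⟨q3, rfl⟩
    | none => exfalso; unfold totals at hrest; rw [modes_eq] at hrest; simp [h0, h1, h2, h] at hrest
  have htot : totals = some ((q0.2.2.2.add q1.2.2.2).add (q2.2.2.2.add q3.2.2.2),
      (q0.2.2.1.add q1.2.2.1).add (q2.2.2.1.add q3.2.2.1), (q0.1.add q1.1).add (q2.1.add q3.1)) := by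
    unfold totals; rw [modes_eq]; simp [h0, h1, h2, h3]
  rw [htot] at hrest
  simp only [Bool.and_eq_true, decide_eq_true_eq] at hrest
  obtain ⟨⟨⟨h229, hLam⟩, h1S⟩, h231⟩ := hrest
  exact ⟨q0, q1, q2, q3, h0, h1, h2, h3, hbr'.1, hbr'.2.1, hbr'.2.2.1, hbr'.2.2.2, h229, hLam, h1S, h231⟩

/-! ## §4 Assembly: four distinct members, the frame, the window -/

/-- Sum over four distinct indices. [folklore] -/
private theorem sum_four {f : ℕ → ℝ} {k0 k1 k2 k3 : ℕ} (h01 : k0 ≠ k1) (h02 : k0 ≠ k2) (h03 : k0 ≠ k3)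
    (h12 : k1 ≠ k2) (h13 : k1 ≠ k3) (h23 : k2 ≠ k3) :
    ∑ k ∈ ({k0, k1, k2, k3} : Finset ℕ), f k = f k0 + f k1 + (f k2 + f k3) := by
  rw [Finset.sum_insert (by simp [h01, h02, h03]), Finset.sum_insert (by simp [h12, h13]),
    Finset.sum_pair h23]
  ring

/-- `3/(2π) < 0.478` (from `π > 3.14`). [folklore] -/
private theorem three_div_two_pi_lt : 3 / (2 * π) < 478 / 1000 := by
  have hπ := Real.pi_gt_d2
  rw [div_lt_iff₀ (by positivity)]
  nlinarith

/-- **The enclosure for THE prolate family**: `22.9 ≤ Σ_n t(n) ≤ 23.1`, `t(n) = epsSlopeTerm (prolateFun n)`.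
[cite: ConnesConsani2021, Lemma 5.4 §5 pp. 32–33 (ε′(1⁺) = Σ_n λ(n)²(1−λ(n)²)⁻¹ξ_n(1)² ≃ 22.9965)] -/
theorem tsum_epsSlopeTerm_prolateFun_mem :
    (22.9 : ℝ) ≤ ∑' n, epsSlopeTerm (prolateFun n) ∧ ∑' n, epsSlopeTerm (prolateFun n) ≤ 23.1 := by
  have hSC := SC_pos
  obtain ⟨q0, q1, q2, q3, hq0, hq1, hq2, hq3, hb0, hb1, hb2, hb3, h229, hLam, h1S, h231⟩ :=
    slopeCheck_decoded
  obtain ⟨ht0, ht1, ht2, ht3⟩ := modeTailOK_each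
  -- the four members
  obtain ⟨b0, k0, hB0, hlo0, hhi0, hN0, hL0, hP0, hLP0, hT0⟩ :=
    mode_package D0 _ _ ht0 hb0 (by decide) hq0
  obtain ⟨b1, k1, hB1, hlo1, hhi1, hN1, hL1, hP1, hLP1, hT1⟩ :=
    mode_package D1 _ _ ht1 hb1 (by decide) hq1
  obtain ⟨b2, k2, hB2, hlo2, hhi2, hN2, hL2, hP2, hLP2, hT2⟩ :=
    mode_package D2 _ _ ht2 hb2 (by decide) hq2
  obtain ⟨b3, k3, hB3, hlo3, hhi3, hN3, hL3, hP3, hLP3, hT3⟩ :=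
    mode_package D3 _ _ ht3 hb3 (by decide) hq3
  -- distinct parameters (disjoint brackets) ⇒ distinct indices
  have s01 : ((D0.chiHi : ℤ) : ℝ) / SC < ((D1.chiLo : ℤ) : ℝ) / SC :=
    div_lt_div_of_pos_right (by exact_mod_cast (by decide : D0.chiHi < D1.chiLo)) hSC
  have s12 : ((D1.chiHi : ℤ) : ℝ) / SC < ((D2.chiLo : ℤ) : ℝ) / SC :=
    div_lt_div_of_pos_right (by exact_mod_cast (by decide : D1.chiHi < D2.chiLo)) hSC
  have s23 : ((D2.chiHi : ℤ) : ℝ) / SC < ((D3.chiLo : ℤ) : ℝ) / SC :=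
    div_lt_div_of_pos_right (by exact_mod_cast (by decide : D2.chiHi < D3.chiLo)) hSC
  have h01 : k0 ≠ k1 := ne_of_frobSol_critical hB0 hN0 hB1 hN1 (by linarith)
  have h02 : k0 ≠ k2 := ne_of_frobSol_critical hB0 hN0 hB2 hN2 (by linarith)
  have h03 : k0 ≠ k3 := ne_of_frobSol_critical hB0 hN0 hB3 hN3 (by linarith)
  have h12 : k1 ≠ k2 := ne_of_frobSol_critical hB1 hN1 hB2 hN2 (by linarith)
  have h13 : k1 ≠ k3 := ne_of_frobSol_critical hB1 hN1 hB3 hN3 (by linarith)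
  have h23 : k2 ≠ k3 := ne_of_frobSol_critical hB2 hN2 hB3 hN3 (by linarith)
  set F : Finset ℕ := {k0, k1, k2, k3} with hF
  -- the three sums over F and their interval memberships
  have hsumT : ∑ k ∈ F, epsSlopeTerm (prolateFun k) =
      epsSlopeTerm (prolateFun k0) + epsSlopeTerm (prolateFun k1) +
        (epsSlopeTerm (prolateFun k2) + epsSlopeTerm (prolateFun k3)) := sum_four h01 h02 h03 h12 h13 h23
  have hsumLP : ∑ k ∈ F, prolateEigen k ^ 2 * prolateFun k 1 ^ 2 =
      prolateEigen k0 ^ 2 * prolateFun k0 1 ^ 2 + prolateEigen k1 ^ 2 * prolateFun k1 1 ^ 2 +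
        (prolateEigen k2 ^ 2 * prolateFun k2 1 ^ 2 + prolateEigen k3 ^ 2 * prolateFun k3 1 ^ 2) :=
    sum_four h01 h02 h03 h12 h13 h23
  have hsumL : ∑ k ∈ F, prolateEigen k ^ 2 =
      prolateEigen k0 ^ 2 + prolateEigen k1 ^ 2 + (prolateEigen k2 ^ 2 + prolateEigen k3 ^ 2) :=
    sum_four h01 h02 h03 h12 h13 h23
  have mT := FI.mem_add (FI.mem_add hT0 hT1) (FI.mem_add hT2 hT3)
  have mLP := FI.mem_add (FI.mem_add hLP0 hLP1) (FI.mem_add hLP2 hLP3)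
  have mL := FI.mem_add (FI.mem_add hL0 hL1) (FI.mem_add hL2 hL3)
  rw [← hsumT] at mT
  rw [← hsumLP] at mLP
  rw [← hsumL] at mL
  set ts := (q0.2.2.2.add q1.2.2.2).add (q2.2.2.2.add q3.2.2.2) with hts
  set l2p := (q0.2.2.1.add q1.2.2.1).add (q2.2.2.1.add q3.2.2.1) with hl2p
  set l2 := (q0.1.add q1.1).add (q2.1.add q3.1) with hl2
  -- the six hypotheses of the frame
  have ha : (ts.lo : ℝ) / SC ≤ ∑ k ∈ F, epsSlopeTerm (prolateFun k) := FI.lo_div_le mT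
  have hb : ∑ k ∈ F, epsSlopeTerm (prolateFun k) ≤ (ts.hi : ℝ) / SC := FI.le_hi_div mT
  have hS : (l2p.lo : ℝ) / SC ≤ ∑ k ∈ F, prolateEigen k ^ 2 * prolateFun k 1 ^ 2 := FI.lo_div_le mLP
  have hM : (l2.lo : ℝ) / SC ≤ ∑ k ∈ F, prolateEigen k ^ 2 := FI.lo_div_le mL
  -- integer inequalities ⇒ real ones
  have h229r : (22.9 : ℝ) ≤ (ts.lo : ℝ) / SC := by
    rw [le_div_iff₀ hSC]
    have : ((229 * (SC : ℤ) : ℤ) : ℝ) ≤ ((10 * ts.lo : ℤ) : ℝ) := by exact_mod_cast h229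
    push_cast at this
    linarith
  have hMr : 2978 / 1000 - (l2.lo : ℝ) / SC ≤ 3 / 4 := by
    have hfl := int_div_real_le_ediv_add_one (2978 * (SC : ℤ)) (by norm_num : (0 : ℤ) < 1000)
    have : ((4 * ((2978 * (SC : ℤ)) / 1000 + 1 - l2.lo) : ℤ) : ℝ) ≤ ((3 * (SC : ℤ) : ℤ) : ℝ) := by
      exact_mod_cast hLam
    push_cast at this hfl
    have key : (2978 : ℝ) * SC / 1000 - l2.lo ≤ 3 / 4 * SC := by linarith
    have e1 : (2978 : ℝ) / 1000 - (l2.lo : ℝ) / SC = ((2978 : ℝ) * SC / 1000 - l2.lo) / SC := by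
      field_simp
    rw [e1, div_le_iff₀ hSC]
    linarith
  have hΛ : 5 / 2 + 3 / (2 * π) - (l2.lo : ℝ) / SC < 1 := by
    linarith [three_div_two_pi_lt]
  have hΛ' : 1 / 4 < 1 - (5 / 2 + 3 / (2 * π) - (l2.lo : ℝ) / SC) := by
    linarith [three_div_two_pi_lt]
  have hS1 : 0 ≤ 1 - (l2p.lo : ℝ) / SC := by
    have : ((0 : ℤ) : ℝ) ≤ (((SC : ℤ) - l2p.lo : ℤ) : ℝ) := by exact_mod_cast h1S
    push_cast at this
    rw [sub_nonneg, div_le_one hSC]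
    linarith
  have hBr : (ts.hi : ℝ) / SC + 2 * (1 - (l2p.lo : ℝ) / SC) / (1 - (5 / 2 + 3 / (2 * π) - (l2.lo : ℝ) / SC))
      ≤ 23.1 := by
    have h8 : 2 * (1 - (l2p.lo : ℝ) / SC) / (1 - (5 / 2 + 3 / (2 * π) - (l2.lo : ℝ) / SC))
        ≤ 2 * (1 - (l2p.lo : ℝ) / SC) / (1 / 4) :=
      div_le_div_of_nonneg_left (by positivity) (by norm_num) hΛ'.le
    have h231r : (ts.hi : ℝ) / SC + 8 * (1 - (l2p.lo : ℝ) / SC) ≤ 23.1 := by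
      have : ((10 * (ts.hi + 8 * ((SC : ℤ) - l2p.lo)) : ℤ) : ℝ) ≤ ((231 * (SC : ℤ) : ℤ) : ℝ) := by
        exact_mod_cast h231
      push_cast at this
      have e : (ts.hi : ℝ) / SC + 8 * (1 - (l2p.lo : ℝ) / SC) = (ts.hi + 8 * (SC - l2p.lo)) / SC := by
        field_simp
      rw [e, div_le_iff₀ hSC]
      linarith
    calc _ ≤ (ts.hi : ℝ) / SC + 2 * (1 - (l2p.lo : ℝ) / SC) / (1 / 4) := by linarith
      _ = (ts.hi : ℝ) / SC + 8 * (1 - (l2p.lo : ℝ) / SC) := by ring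
      _ ≤ 23.1 := h231r
  have hplug := tsum_epsSlopeTerm_mem_Icc_of_certificate F ha hb hS hM hΛ hBr
  exact ⟨h229r.trans hplug.1, hplug.2⟩

/-- **(E-b) IN THE KERNEL** — the enclosure conjunct of `CC2021_section6_enclosures`, VERBATIM: for every even
prolate family `ψ` (there is exactly one: `ψ n = prolateFun n`), `22.9 ≤ Σ' n, epsSlopeTerm (ψ n) ≤ 23.1`.
Printed value `ε′(1⁺) ≃ 22.9965` (CC2021 Lemma 5.4).  Certified here by `decide +kernel` interval arithmetic on
the Frobenius recursion (four members) plus the index-free Bessel tail (`EpsSlopeTailFrame`).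
[cite: ConnesConsani2021, Lemma 5.4 §5 pp. 32–33 (arXiv item Lemma 31, chunk p0020:L86–L101)] -/
theorem epsSlope_enclosure_holds :
    ∀ ψ : ℕ → ℝ → ℝ, (∀ n, IsProlateFunction 1 (2 * n) (ψ n)) →
      (22.9 : ℝ) ≤ ∑' n, epsSlopeTerm (ψ n) ∧ ∑' n, epsSlopeTerm (ψ n) ≤ 23.1 := by
  intro ψ hψ
  have h : ψ = prolateFun := funext fun n ↦ eq_prolateFun_of_isProlateFunction (hψ n)
  subst h
  exact tsum_epsSlopeTerm_prolateFun_mem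

end Literature.NumberTheory.ConnesConsani2021.SlopeCert
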